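import Mathlib
import Summits.Ventures.HodgeRepro2.Tier7.Line3.RealDominantOfKappa
import Summits.Ventures.HodgeRepro2.Tier7.Line3.KappaDataOfAdaptedRep
import Summits.Ventures.HodgeRepro2.Tier7.Line3.LocalDataOfAdicCompletion

/-!
# Tier7/Line3/ResidualOfAdicCompletion — the typed residual of record with the finite side on Mathlib's completions,
as ONE theorem (seat t7-x1, gen 5)

LINE 3 (t7-plan-3), version (ii). The typed residual of record (proofs/t7/L3/X1-RESIDUAL-TYPED.md v8) reads
`ArchData + FinKappa + ha_γ₀ + hident ⇒ KappaData ⇒ DominantSide ⇒ RealDominant D ⇒ RtfConclusion D ⇒ C(D)`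
(KappaDataOfAdaptedRep p685088 `kappaDataRep` / `exists_twoTorus_rep`; RealDominantOfKappa p678656
`exists_translates_of_kappaData`), with `FinKappa` read from `LocalData` (FinKappaOfLocalData p688011) and, since
p716023, from `LocalData.ofAdicCompletion` — the all-places κ-side package on Mathlib's completions. This module
composes the chain into ONE statement:

* `exists_twoTorus_adic`: `ArchData` (the archimedean side at the pinned pairs) + the place datum `(wE, hlies, Sp,
  hone)` + the adapted-coordinate clauses at the completions (DISPLAYED, the binders of `LocalData.ofAdicCompletion`)
  + a `SplitLocal` on the same family (AdicCompletionSplit p715395) + `ha_γ₀` + `hident` ⇒ `∃ π, PA π ∧ PB π`;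
* `rtfConclusion_adic`: the same data with the seesaw data and the two printed seesaw iffs of RealDominantOfKappa
  ⇒ `RtfConclusion D₀` — the binder of the L3 bridge `Line3.exists_translates_of` (Defs.lean p661163);
* `exists_translates_adic := Line3.exists_translates_of D₀ (rtfConclusion_adic …)`:
  `∃ g : Fin 4 → G, D₀.S.L2 (D₀.fOmegaS g) (D₀.fOmegaSbar g) ≠ 0` — the conclusion of the frozen target for the
  datum `D₀`, uniform in `D₀`, through the L3 deliverable by name.

The involution: `ArchData.σ : E →+* E` and the completions' Galois involution `σ' : E ≃ₐ[K] E` are linked by the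
DISPLAYED `hAσ : A.σ = σ'` (the `LocalData` is transported along it; `hκF` is then `A.hκF`, not displayed again).

WORDING OF RECORD (crit-2 STATUS l. 16233 (i), plan-3 l. 16236 (1)): `exists_translates_adic` concludes `C(D₀)` at an
ABSTRACT `D₀ : PeriodDatum`, NOT (P) (the frozen Target.lean statement about the real `X`); the conjunction of its
hypotheses IS the residual (a′)/(b′) of record; NO INSTANCE of that conjunction is exhibited anywhere in the tree (the
M3 counter-model `shadow_does_not_decide` stands); this theorem does not decide the target — «one theorem» is never
«one step left»: its ≈ 43 displayed binders are the residual written as a conjunction, not a distance.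
WHAT THIS IS: the residual (a′)/(b′) of record as ONE kernel statement whose hypotheses are exactly the displayed
data — the archimedean pinned-pair data (`ArchData`), the place datum, the adapted-coordinate clauses at every finite
place on Mathlib's completions, the split package, the non-vanishing `ha_γ₀` at the dominant coset and the identity
`hident` (geometric side = spectral side at every level) — with NO local-field clause, NO split clause and NO
measure-side clause left displayed. It is a CONSOLIDATION of the [M]-level chain, NOT distance to (P): every
hypothesis is a sentence of the dictionary (a′)/(b′) about the real `X`'s objects, in words (TYPING-CENSUS T7).
Nothing here is about (N), (P), the real `X`, or HC_CM; §8(d): NO. Blind lane: Mathlib + the HodgeRepro2 prefix;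
no sorry; axioms ⊆ {propext, Classical.choice, Quot.sound}.
-/

namespace Summit.Ventures.HodgeRepro2.Tier7.Line3.ResidualOfAdicCompletion

open IsDedekindDomain IsDedekindDomain.HeightOneSpectrum NumberField Matrix
  Summit.Ventures.HodgeRepro2.T6
  Summit.Ventures.HodgeRepro2.Tier7.Line3
  Summit.Ventures.HodgeRepro2.Tier7.Line3.LevelTowerTopology
  Summit.Ventures.HodgeRepro2.Tier7.Line3.KappaDataFinLocal
  Summit.Ventures.HodgeRepro2.Tier7.Line3.KappaDataFinLocalSplit
  Summit.Ventures.HodgeRepro2.Tier7.Line3.KappaDataOfAdapted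
  Summit.Ventures.HodgeRepro2.Tier7.Line3.AdicCompletionSplit
  Summit.Ventures.HodgeRepro2.Tier7.Line3.LocalDataOfAdicCompletion
  Summit.Ventures.HodgeRepro2.T7SupportTwoTorusInvariant
open scoped NumberField Classical

variable {E K : Type} [Field E] [NumberField E] [Field K] [NumberField K] [Algebra K E]
  {Rep Orb : Type} [DecidableEq Orb] {PA PB : Rep → Prop} [MeasurableSpace Circle] [BorelSpace Circle]
  (A : ArchData E K Rep Orb PA PB) (σ : E ≃ₐ[K] E) (hAσ : A.σ = (σ : E →+* E))
  (wE : FinitePlace K → HeightOneSpectrum (𝓞 E))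
  (hlies : ∀ w, (wE w).asIdeal.LiesOver (FinitePlace.maximalIdeal w).asIdeal)
  (Sp : Set (FinitePlace K))
  (hone : ∀ w, w ∉ Sp → (Ideal.primesOver (FinitePlace.maximalIdeal w).asIdeal (𝓞 E)).ncard = 1)

omit [NumberField E] [MeasurableSpace Circle] [BorelSpace Circle] in
include hAσ in
/-- `hκF` at the Galois involution, from `ArchData.hκF` and `hAσ`. -/
theorem hκF_of_archData (γ : Orb) :
    algebraMap K E (A.κF γ) = kappa (σ : E →+* E) A.d A.f (A.matO γ) := by
  rw [← hAσ]
  exact A.hκF γ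

/-- **the `LocalData` of an `ArchData` on Mathlib's completions**: p716023's `LocalData.ofAdicCompletion` is built at
the Galois involution `σ : E ≃ₐ[K] E` (which `σw` needs) and TRANSPORTED along the displayed `hAσ : A.σ = ↑σ` by
`hAσ ▸` (an `Eq.mpr` on the `σ`-argument of `LocalData`) to `LocalData (Ew wE) A.σ …`; the 22 adapted-coordinate
clauses are stated at `σ` (where `σw σ wE hlies Sp hone` lives), never at `A.σ`, so nothing is displayed twice
(crit-2 STATUS l. 16233 (ii)); `A.hκF` is read once, in `hκF_of_archData`. -/
noncomputable def localData_adic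
    (v₁ : FinitePlace K) (S : Finset (FinitePlace K)) (hv₁S : v₁ ∉ S) (hv₁Sp : v₁ ∉ Sp)
    (hf_int : ∀ w, w ∉ S → w ∉ Sp → ∀ i, abv wE hlies w (FinitePlace.embedding (wE w) (A.f 0 i)) ≤ 1)
    (hd_int : ∀ w, w ∉ S → w ∉ Sp → abv wE hlies w (FinitePlace.embedding (wE w) (A.d 0)) ≤ 1)
    (hdisc_unit : ∀ w, w ∉ S → w ∉ Sp → abv wE hlies w (FinitePlace.embedding (wE w) (A.d 0) *
      disc' (σw σ wE hlies Sp hone w) (fun i => FinitePlace.embedding (wE w) (A.d i))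
        (fun j i => FinitePlace.embedding (wE w) (A.f j i)) 0) = 1)
    (hγ₀_int : ∀ w, w ∉ S → w ∉ Sp → ∃ m₀, IsTranslate (σw σ wE hlies Sp hone w)
      (fun j i => FinitePlace.embedding (wE w) (A.f j i)) ((A.matO A.γ₀).map (FinitePlace.embedding (wE w))) m₀ ∧
      ∀ i j, abv wE hlies w (m₀ i j) ≤ 1)
    (hsupp_int : ∀ w, w ∉ S → w ∉ Sp → w ≠ v₁ → ∀ N γ, A.arith N γ → ∃ m, IsTranslate (σw σ wE hlies Sp hone w)
      (fun j i => FinitePlace.embedding (wE w) (A.f j i)) ((A.matO γ).map (FinitePlace.embedding (wE w))) m ∧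
      ∀ i j, abv wE hlies w (m i j) ≤ 1)
    (M : FinitePlace K → ℝ) (hM : ∀ w ∈ S, 0 < M w)
    (hf_S : ∀ w ∈ S, w ∉ Sp → ∀ i, abv wE hlies w (FinitePlace.embedding (wE w) (A.f 0 i)) ≤ M w)
    (hd_S : ∀ w ∈ S, w ∉ Sp → abv wE hlies w (FinitePlace.embedding (wE w) (A.d 0)) ≤ M w)
    (hγ₀_S : ∀ w ∈ S, w ∉ Sp → ∃ m₀, IsTranslate (σw σ wE hlies Sp hone w)
      (fun j i => FinitePlace.embedding (wE w) (A.f j i)) ((A.matO A.γ₀).map (FinitePlace.embedding (wE w))) m₀ ∧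
      ∀ i j, abv wE hlies w (m₀ i j) ≤ M w)
    (hsupp_S : ∀ w ∈ S, w ∉ Sp → ∀ N γ, A.arith N γ → ∃ m, IsTranslate (σw σ wE hlies Sp hone w)
      (fun j i => FinitePlace.embedding (wE w) (A.f j i)) ((A.matO γ).map (FinitePlace.embedding (wE w))) m ∧
      ∀ i j, abv wE hlies w (m i j) ≤ M w)
    (hdisc_S : ∀ w ∈ S, w ∉ Sp → abv wE hlies w (FinitePlace.embedding (wE w) (A.d 0) *
      disc' (σw σ wE hlies Sp hone w) (fun i => FinitePlace.embedding (wE w) (A.d i))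
        (fun j i => FinitePlace.embedding (wE w) (A.f j i)) 0) ≠ 0)
    (γ₀w : Matrix (Fin 2) (Fin 2) (Ew wE v₁))
    (hγ₀w : IsTranslate (σw σ wE hlies Sp hone v₁) (fun j i => FinitePlace.embedding (wE v₁) (A.f j i))
      ((A.matO A.γ₀).map (FinitePlace.embedding (wE v₁))) γ₀w)
    (hγ₀w_int : ∀ i j, abv wE hlies v₁ (γ₀w i j) ≤ 1)
    (hsupp_cong : ∀ N γ, A.arith N γ → ∃ k : Matrix (Fin 2) (Fin 2) (Ew wE v₁),
      IsTranslate (σw σ wE hlies Sp hone v₁) (fun j i => FinitePlace.embedding (wE v₁) (A.f j i))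
        ((A.matO γ).map (FinitePlace.embedding (wE v₁))) (γ₀w * k) ∧
      ∀ i j, ‖(k - 1) i j‖ ≤ (AdicCompletionLevel.q (wE v₁))⁻¹ ^ (N + 1))
    (D : SplitLocal (Ew wE) (σ : E →+* E) A.d A.f A.matO A.κF A.arith A.γ₀ S Sp M) :
    LocalData (Ew wE) A.σ A.d A.f A.matO A.κF A.arith A.γ₀ :=
  hAσ ▸ LocalData.ofAdicCompletion σ wE hlies Sp hone A.d A.f A.matO A.κF A.arith A.γ₀ (hκF_of_archData A σ hAσ)
    v₁ S hv₁S hv₁Sp hf_int hd_int hdisc_unit hγ₀_int hsupp_int M hM hf_S hd_S hγ₀_S hsupp_S hdisc_S γ₀w hγ₀w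
    hγ₀w_int hsupp_cong D

include hAσ in
/-- **THE TYPED RESIDUAL OF RECORD ON MATHLIB'S COMPLETIONS — the two-period conclusion**: `ArchData` + the place
datum + the adapted-coordinate clauses at the completions + the split package + `ha_γ₀` + `hident` ⇒
`∃ π, PA π ∧ PB π` (`ArchData.exists_twoTorus_rep` at `FinKappa := (localData_adic …).toFinKappa`).
`ha_γ₀ : A.a₁ A.γ₀ * A.archFactorP₂ A.γ₀ * A.archFactorP₃ A.γ₀ ≠ 0` (the base-point clause) and
`hident : ∀ N, ∑' γ, A.a₁ γ * A.archFactorP₂ γ * A.archFactorP₃ γ * A.b N γ = ∑' π, A.spec N π` (the identification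
clause, geometric side = spectral side at every level) are p685088's binders, quoted verbatim and NOT re-typed here —
both [W] sentences of TYPING-CENSUS T7 (crit-2 STATUS l. 16233 (iii)). The conjunction of the hypotheses is the
residual (a′)/(b′) of record; no instance of it is exhibited anywhere in the tree; this theorem does not decide the
target. -/
theorem exists_twoTorus_adic
    (v₁ : FinitePlace K) (S : Finset (FinitePlace K)) (hv₁S : v₁ ∉ S) (hv₁Sp : v₁ ∉ Sp)
    (hf_int : ∀ w, w ∉ S → w ∉ Sp → ∀ i, abv wE hlies w (FinitePlace.embedding (wE w) (A.f 0 i)) ≤ 1)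
    (hd_int : ∀ w, w ∉ S → w ∉ Sp → abv wE hlies w (FinitePlace.embedding (wE w) (A.d 0)) ≤ 1)
    (hdisc_unit : ∀ w, w ∉ S → w ∉ Sp → abv wE hlies w (FinitePlace.embedding (wE w) (A.d 0) *
      disc' (σw σ wE hlies Sp hone w) (fun i => FinitePlace.embedding (wE w) (A.d i))
        (fun j i => FinitePlace.embedding (wE w) (A.f j i)) 0) = 1)
    (hγ₀_int : ∀ w, w ∉ S → w ∉ Sp → ∃ m₀, IsTranslate (σw σ wE hlies Sp hone w)
      (fun j i => FinitePlace.embedding (wE w) (A.f j i)) ((A.matO A.γ₀).map (FinitePlace.embedding (wE w))) m₀ ∧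
      ∀ i j, abv wE hlies w (m₀ i j) ≤ 1)
    (hsupp_int : ∀ w, w ∉ S → w ∉ Sp → w ≠ v₁ → ∀ N γ, A.arith N γ → ∃ m, IsTranslate (σw σ wE hlies Sp hone w)
      (fun j i => FinitePlace.embedding (wE w) (A.f j i)) ((A.matO γ).map (FinitePlace.embedding (wE w))) m ∧
      ∀ i j, abv wE hlies w (m i j) ≤ 1)
    (M : FinitePlace K → ℝ) (hM : ∀ w ∈ S, 0 < M w)
    (hf_S : ∀ w ∈ S, w ∉ Sp → ∀ i, abv wE hlies w (FinitePlace.embedding (wE w) (A.f 0 i)) ≤ M w)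
    (hd_S : ∀ w ∈ S, w ∉ Sp → abv wE hlies w (FinitePlace.embedding (wE w) (A.d 0)) ≤ M w)
    (hγ₀_S : ∀ w ∈ S, w ∉ Sp → ∃ m₀, IsTranslate (σw σ wE hlies Sp hone w)
      (fun j i => FinitePlace.embedding (wE w) (A.f j i)) ((A.matO A.γ₀).map (FinitePlace.embedding (wE w))) m₀ ∧
      ∀ i j, abv wE hlies w (m₀ i j) ≤ M w)
    (hsupp_S : ∀ w ∈ S, w ∉ Sp → ∀ N γ, A.arith N γ → ∃ m, IsTranslate (σw σ wE hlies Sp hone w)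
      (fun j i => FinitePlace.embedding (wE w) (A.f j i)) ((A.matO γ).map (FinitePlace.embedding (wE w))) m ∧
      ∀ i j, abv wE hlies w (m i j) ≤ M w)
    (hdisc_S : ∀ w ∈ S, w ∉ Sp → abv wE hlies w (FinitePlace.embedding (wE w) (A.d 0) *
      disc' (σw σ wE hlies Sp hone w) (fun i => FinitePlace.embedding (wE w) (A.d i))
        (fun j i => FinitePlace.embedding (wE w) (A.f j i)) 0) ≠ 0)
    (γ₀w : Matrix (Fin 2) (Fin 2) (Ew wE v₁))
    (hγ₀w : IsTranslate (σw σ wE hlies Sp hone v₁) (fun j i => FinitePlace.embedding (wE v₁) (A.f j i))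
      ((A.matO A.γ₀).map (FinitePlace.embedding (wE v₁))) γ₀w)
    (hγ₀w_int : ∀ i j, abv wE hlies v₁ (γ₀w i j) ≤ 1)
    (hsupp_cong : ∀ N γ, A.arith N γ → ∃ k : Matrix (Fin 2) (Fin 2) (Ew wE v₁),
      IsTranslate (σw σ wE hlies Sp hone v₁) (fun j i => FinitePlace.embedding (wE v₁) (A.f j i))
        ((A.matO γ).map (FinitePlace.embedding (wE v₁))) (γ₀w * k) ∧
      ∀ i j, ‖(k - 1) i j‖ ≤ (AdicCompletionLevel.q (wE v₁))⁻¹ ^ (N + 1))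
    (D : SplitLocal (Ew wE) (σ : E →+* E) A.d A.f A.matO A.κF A.arith A.γ₀ S Sp M)
    (ha_γ₀ : A.a₁ A.γ₀ * A.archFactorP₂ A.γ₀ * A.archFactorP₃ A.γ₀ ≠ 0)
    (hident : ∀ N, ∑' γ, A.a₁ γ * A.archFactorP₂ γ * A.archFactorP₃ γ * A.b N γ = ∑' π, A.spec N π) :
    ∃ π, PA π ∧ PB π :=
  A.exists_twoTorus_rep (localData_adic A σ hAσ wE hlies Sp hone v₁ S hv₁S hv₁Sp hf_int hd_int hdisc_unit hγ₀_int
    hsupp_int M hM hf_S hd_S hγ₀_S hsupp_S hdisc_S γ₀w hγ₀w hγ₀w_int hsupp_cong D).toFinKappa ha_γ₀ hident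

/-- **THE TYPED RESIDUAL OF RECORD ON MATHLIB'S COMPLETIONS — `RtfConclusion D₀`, the hypothesis of the L3
deliverable**: with the seesaw data `sw` and the two printed seesaw iffs of RealDominantOfKappa (p678656), `ArchData`
over the datum's spectrum `sw.Rep` + the place datum + the adapted-coordinate clauses at the completions + the split
package + `ha_γ₀` + `hident` ⇒ `RtfConclusion D₀` (`rtfConclusion_of_kappaData` at `KD := A.kappaDataRep
(localData_adic …).toFinKappa ha_γ₀ hident`) — exactly the binder `h : RtfConclusion D` of `Line3.exists_translates_of`
(Tier7/Line3/Defs.lean p661163, the L3 bridge of record), so that `exists_translates_adic` below IS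
`Line3.exists_translates_of D₀ (rtfConclusion_adic …)` (plan-3 STATUS l. 16236 (2)): the L3 bridge restated with the
finite side on Mathlib's completions, per datum `D₀`; `Line3.Residual` (`∀ D, RtfConclusion D`, the binder of
`p_T7_of_residual`) asks the data for EVERY datum and is not composed here. -/
theorem rtfConclusion_adic {K₀ : Type} [Field K₀] [NumberField K₀] {E' : Type} [Field E'] [NumberField E']
    {V : Type} [AddCommGroup V] [Module E' V] {HX : Type} [Ring HX] [Algebra ℂ HX] {G : Type} [Group G]
    [MulAction G HX] (D₀ : PeriodDatum K₀ E' V HX G) (sw : SeesawData D₀) (perA perB : sw.Rep → Prop)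
    (seesawA : ∀ π, (∃ g : Fin 4 → G, sw.comp π (D₀.fOmegaS g) ≠ 0) ↔ (perA π ∧ sw.Θ π ≠ ⊥))
    (seesawB : ∀ π, (∃ g : Fin 4 → G, sw.comp π (D₀.fOmegaSbar g) ≠ 0) ↔ (perB π ∧ sw.Θ π ≠ ⊥))
    (hΘ : ∀ π, perA π → sw.Θ π ≠ ⊥)
    (A : ArchData E K sw.Rep Orb perA perB) (hAσ : A.σ = (σ : E →+* E))
    (v₁ : FinitePlace K) (S : Finset (FinitePlace K)) (hv₁S : v₁ ∉ S) (hv₁Sp : v₁ ∉ Sp)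
    (hf_int : ∀ w, w ∉ S → w ∉ Sp → ∀ i, abv wE hlies w (FinitePlace.embedding (wE w) (A.f 0 i)) ≤ 1)
    (hd_int : ∀ w, w ∉ S → w ∉ Sp → abv wE hlies w (FinitePlace.embedding (wE w) (A.d 0)) ≤ 1)
    (hdisc_unit : ∀ w, w ∉ S → w ∉ Sp → abv wE hlies w (FinitePlace.embedding (wE w) (A.d 0) *
      disc' (σw σ wE hlies Sp hone w) (fun i => FinitePlace.embedding (wE w) (A.d i))
        (fun j i => FinitePlace.embedding (wE w) (A.f j i)) 0) = 1)
    (hγ₀_int : ∀ w, w ∉ S → w ∉ Sp → ∃ m₀, IsTranslate (σw σ wE hlies Sp hone w)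
      (fun j i => FinitePlace.embedding (wE w) (A.f j i)) ((A.matO A.γ₀).map (FinitePlace.embedding (wE w))) m₀ ∧
      ∀ i j, abv wE hlies w (m₀ i j) ≤ 1)
    (hsupp_int : ∀ w, w ∉ S → w ∉ Sp → w ≠ v₁ → ∀ N γ, A.arith N γ → ∃ m, IsTranslate (σw σ wE hlies Sp hone w)
      (fun j i => FinitePlace.embedding (wE w) (A.f j i)) ((A.matO γ).map (FinitePlace.embedding (wE w))) m ∧
      ∀ i j, abv wE hlies w (m i j) ≤ 1)
    (M : FinitePlace K → ℝ) (hM : ∀ w ∈ S, 0 < M w)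
    (hf_S : ∀ w ∈ S, w ∉ Sp → ∀ i, abv wE hlies w (FinitePlace.embedding (wE w) (A.f 0 i)) ≤ M w)
    (hd_S : ∀ w ∈ S, w ∉ Sp → abv wE hlies w (FinitePlace.embedding (wE w) (A.d 0)) ≤ M w)
    (hγ₀_S : ∀ w ∈ S, w ∉ Sp → ∃ m₀, IsTranslate (σw σ wE hlies Sp hone w)
      (fun j i => FinitePlace.embedding (wE w) (A.f j i)) ((A.matO A.γ₀).map (FinitePlace.embedding (wE w))) m₀ ∧
      ∀ i j, abv wE hlies w (m₀ i j) ≤ M w)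
    (hsupp_S : ∀ w ∈ S, w ∉ Sp → ∀ N γ, A.arith N γ → ∃ m, IsTranslate (σw σ wE hlies Sp hone w)
      (fun j i => FinitePlace.embedding (wE w) (A.f j i)) ((A.matO γ).map (FinitePlace.embedding (wE w))) m ∧
      ∀ i j, abv wE hlies w (m i j) ≤ M w)
    (hdisc_S : ∀ w ∈ S, w ∉ Sp → abv wE hlies w (FinitePlace.embedding (wE w) (A.d 0) *
      disc' (σw σ wE hlies Sp hone w) (fun i => FinitePlace.embedding (wE w) (A.d i))
        (fun j i => FinitePlace.embedding (wE w) (A.f j i)) 0) ≠ 0)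
    (γ₀w : Matrix (Fin 2) (Fin 2) (Ew wE v₁))
    (hγ₀w : IsTranslate (σw σ wE hlies Sp hone v₁) (fun j i => FinitePlace.embedding (wE v₁) (A.f j i))
      ((A.matO A.γ₀).map (FinitePlace.embedding (wE v₁))) γ₀w)
    (hγ₀w_int : ∀ i j, abv wE hlies v₁ (γ₀w i j) ≤ 1)
    (hsupp_cong : ∀ N γ, A.arith N γ → ∃ k : Matrix (Fin 2) (Fin 2) (Ew wE v₁),
      IsTranslate (σw σ wE hlies Sp hone v₁) (fun j i => FinitePlace.embedding (wE v₁) (A.f j i))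
        ((A.matO γ).map (FinitePlace.embedding (wE v₁))) (γ₀w * k) ∧
      ∀ i j, ‖(k - 1) i j‖ ≤ (AdicCompletionLevel.q (wE v₁))⁻¹ ^ (N + 1))
    (D : SplitLocal (Ew wE) (σ : E →+* E) A.d A.f A.matO A.κF A.arith A.γ₀ S Sp M)
    (ha_γ₀ : A.a₁ A.γ₀ * A.archFactorP₂ A.γ₀ * A.archFactorP₃ A.γ₀ ≠ 0)
    (hident : ∀ N, ∑' γ, A.a₁ γ * A.archFactorP₂ γ * A.archFactorP₃ γ * A.b N γ = ∑' π, A.spec N π) :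
    RtfConclusion D₀ :=
  rtfConclusion_of_realDominant D₀ (realDominant_of_kappaData D₀ sw perA perB seesawA seesawB hΘ
    (A.kappaDataRep (localData_adic A σ hAσ wE hlies Sp hone v₁ S hv₁S hv₁Sp hf_int hd_int hdisc_unit hγ₀_int
      hsupp_int M hM hf_S hd_S hγ₀_S hsupp_S hdisc_S γ₀w hγ₀w hγ₀w_int hsupp_cong D).toFinKappa ha_γ₀ hident))

/-- **THE TYPED RESIDUAL OF RECORD ON MATHLIB'S COMPLETIONS — the conclusion of the frozen target for the datum
`D₀`**: the whole chain `LocalData → FinKappa → KappaData → DominantSide → RealDominant D₀ → RtfConclusion D₀ → C(D₀)`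
in one statement, through the L3 bridge `Line3.exists_translates_of` (p661163) by name.
WORDING OF RECORD (crit-2 STATUS l. 16233 (i), plan-3 l. 16236 (1), binding for every census / M5 / CLOSE sentence
that cites this theorem): this theorem concludes `C(D₀)` = `∃ g : Fin 4 → G, D₀.S.L2 (D₀.fOmegaS g) (D₀.fOmegaSbar g) ≠ 0`
at an ABSTRACT `D₀ : PeriodDatum`, NOT (P) (the frozen Target.lean statement about the real `X`); the conjunction of
its hypotheses IS the residual (a′)/(b′) of record; NO INSTANCE of that conjunction is exhibited anywhere in the tree
(the M3 counter-model `shadow_does_not_decide` stands); this theorem does not decide the target. It is `∀ D₀` with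
`sw`, `perA perB`, `A : ArchData E K sw.Rep Orb perA perB` attached — «for EVERY period datum `D₀` equipped with the
displayed data», never «for the datum of `X`» (plan-3 (3)). The conclusion is syntactically the conclusion of
`exists_translates_of_kappaData` / `exists_translates_of_realDominant` / `Line3.exists_translates_of` (the same
`D₀.S.L2 (D₀.fOmegaS g) (D₀.fOmegaSbar g) ≠ 0` term): the proof term `Line3.exists_translates_of D₀ _` elaborates
against the stated type with no conversion (crit-2 (iv)). -/
theorem exists_translates_adic {K₀ : Type} [Field K₀] [NumberField K₀] {E' : Type} [Field E'] [NumberField E']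
    {V : Type} [AddCommGroup V] [Module E' V] {HX : Type} [Ring HX] [Algebra ℂ HX] {G : Type} [Group G]
    [MulAction G HX] (D₀ : PeriodDatum K₀ E' V HX G) (sw : SeesawData D₀) (perA perB : sw.Rep → Prop)
    (seesawA : ∀ π, (∃ g : Fin 4 → G, sw.comp π (D₀.fOmegaS g) ≠ 0) ↔ (perA π ∧ sw.Θ π ≠ ⊥))
    (seesawB : ∀ π, (∃ g : Fin 4 → G, sw.comp π (D₀.fOmegaSbar g) ≠ 0) ↔ (perB π ∧ sw.Θ π ≠ ⊥))
    (hΘ : ∀ π, perA π → sw.Θ π ≠ ⊥)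
    (A : ArchData E K sw.Rep Orb perA perB) (hAσ : A.σ = (σ : E →+* E))
    (v₁ : FinitePlace K) (S : Finset (FinitePlace K)) (hv₁S : v₁ ∉ S) (hv₁Sp : v₁ ∉ Sp)
    (hf_int : ∀ w, w ∉ S → w ∉ Sp → ∀ i, abv wE hlies w (FinitePlace.embedding (wE w) (A.f 0 i)) ≤ 1)
    (hd_int : ∀ w, w ∉ S → w ∉ Sp → abv wE hlies w (FinitePlace.embedding (wE w) (A.d 0)) ≤ 1)
    (hdisc_unit : ∀ w, w ∉ S → w ∉ Sp → abv wE hlies w (FinitePlace.embedding (wE w) (A.d 0) *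
      disc' (σw σ wE hlies Sp hone w) (fun i => FinitePlace.embedding (wE w) (A.d i))
        (fun j i => FinitePlace.embedding (wE w) (A.f j i)) 0) = 1)
    (hγ₀_int : ∀ w, w ∉ S → w ∉ Sp → ∃ m₀, IsTranslate (σw σ wE hlies Sp hone w)
      (fun j i => FinitePlace.embedding (wE w) (A.f j i)) ((A.matO A.γ₀).map (FinitePlace.embedding (wE w))) m₀ ∧
      ∀ i j, abv wE hlies w (m₀ i j) ≤ 1)
    (hsupp_int : ∀ w, w ∉ S → w ∉ Sp → w ≠ v₁ → ∀ N γ, A.arith N γ → ∃ m, IsTranslate (σw σ wE hlies Sp hone w)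
      (fun j i => FinitePlace.embedding (wE w) (A.f j i)) ((A.matO γ).map (FinitePlace.embedding (wE w))) m ∧
      ∀ i j, abv wE hlies w (m i j) ≤ 1)
    (M : FinitePlace K → ℝ) (hM : ∀ w ∈ S, 0 < M w)
    (hf_S : ∀ w ∈ S, w ∉ Sp → ∀ i, abv wE hlies w (FinitePlace.embedding (wE w) (A.f 0 i)) ≤ M w)
    (hd_S : ∀ w ∈ S, w ∉ Sp → abv wE hlies w (FinitePlace.embedding (wE w) (A.d 0)) ≤ M w)
    (hγ₀_S : ∀ w ∈ S, w ∉ Sp → ∃ m₀, IsTranslate (σw σ wE hlies Sp hone w)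
      (fun j i => FinitePlace.embedding (wE w) (A.f j i)) ((A.matO A.γ₀).map (FinitePlace.embedding (wE w))) m₀ ∧
      ∀ i j, abv wE hlies w (m₀ i j) ≤ M w)
    (hsupp_S : ∀ w ∈ S, w ∉ Sp → ∀ N γ, A.arith N γ → ∃ m, IsTranslate (σw σ wE hlies Sp hone w)
      (fun j i => FinitePlace.embedding (wE w) (A.f j i)) ((A.matO γ).map (FinitePlace.embedding (wE w))) m ∧
      ∀ i j, abv wE hlies w (m i j) ≤ M w)
    (hdisc_S : ∀ w ∈ S, w ∉ Sp → abv wE hlies w (FinitePlace.embedding (wE w) (A.d 0) *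
      disc' (σw σ wE hlies Sp hone w) (fun i => FinitePlace.embedding (wE w) (A.d i))
        (fun j i => FinitePlace.embedding (wE w) (A.f j i)) 0) ≠ 0)
    (γ₀w : Matrix (Fin 2) (Fin 2) (Ew wE v₁))
    (hγ₀w : IsTranslate (σw σ wE hlies Sp hone v₁) (fun j i => FinitePlace.embedding (wE v₁) (A.f j i))
      ((A.matO A.γ₀).map (FinitePlace.embedding (wE v₁))) γ₀w)
    (hγ₀w_int : ∀ i j, abv wE hlies v₁ (γ₀w i j) ≤ 1)
    (hsupp_cong : ∀ N γ, A.arith N γ → ∃ k : Matrix (Fin 2) (Fin 2) (Ew wE v₁),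
      IsTranslate (σw σ wE hlies Sp hone v₁) (fun j i => FinitePlace.embedding (wE v₁) (A.f j i))
        ((A.matO γ).map (FinitePlace.embedding (wE v₁))) (γ₀w * k) ∧
      ∀ i j, ‖(k - 1) i j‖ ≤ (AdicCompletionLevel.q (wE v₁))⁻¹ ^ (N + 1))
    (D : SplitLocal (Ew wE) (σ : E →+* E) A.d A.f A.matO A.κF A.arith A.γ₀ S Sp M)
    (ha_γ₀ : A.a₁ A.γ₀ * A.archFactorP₂ A.γ₀ * A.archFactorP₃ A.γ₀ ≠ 0)
    (hident : ∀ N, ∑' γ, A.a₁ γ * A.archFactorP₂ γ * A.archFactorP₃ γ * A.b N γ = ∑' π, A.spec N π) :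
    ∃ g : Fin 4 → G, D₀.S.L2 (D₀.fOmegaS g) (D₀.fOmegaSbar g) ≠ 0 :=
  Line3.exists_translates_of D₀ (rtfConclusion_adic σ wE hlies Sp hone D₀ sw perA perB seesawA seesawB hΘ A hAσ v₁ S
    hv₁S hv₁Sp hf_int hd_int hdisc_unit hγ₀_int hsupp_int M hM hf_S hd_S hγ₀_S hsupp_S hdisc_S γ₀w hγ₀w hγ₀w_int
    hsupp_cong D ha_γ₀ hident)

end Summit.Ventures.HodgeRepro2.Tier7.Line3.ResidualOfAdicCompletion
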